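import Literature.AlgebraicGeometry.HodgeTheory.WeilClasses
import Literature.AlgebraicGeometry.HodgeTheory.HodgeConjecture
import HarnessLib

/-!
# Weil classes on complex abelian fourfolds are algebraic (Markman 2025), on the real carriers

Family `hodge`, layer `Literature/AlgebraicGeometry/HodgeTheory`. A KNOWN CASE of the Hodge
conjecture, stated on the real carriers of this layer (`complexBetti`, `IsRationalClass`,
`IsOfHodgeType`, `algebraicClasses`) and on the Weil plane `weilClassesOf A φ n d = E₊ ⊔ E₋`
of `HodgeTheory/WeilClasses` (van Geemen 4.9: `⋀^{2n}_K H¹ ⊗ ℂ`, cut out by pull-backs along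
`x·𝟙 + y·φ`), in the pattern of the sibling known-case files `LefschetzOneOne`,
`FermatHodgeConjecture`, `CubicFourfoldHodgeConjecture`.

Sources READ (held):

* E. Markman, *Secant sheaves and Weil classes on abelian varieties*, arXiv:2509.23403 (2025)
  [`Markman2025SurveySecant`], **Theorem 1.2** (PDF text chunk 3), verbatim: "The Weil classes for
  abelian fourfolds of Weil type and abelian sixfolds of split Weil type with complex multiplication
  by a quadratic imaginary number field `K` are algebraic."; §11.5 Step 2 (chunk 19), verbatim: "for
  every polarized abelian fourfold `(A₁,η₁,h₁)` of Weil type, of arbitrary discriminant, there exists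
  a polarized abelian surface of Weil type `(A₂,η₂,h₂)`, such that the discriminant of their product
  polarized abelian sixfold of Weil type … is the coset of `-1`. The sixfold is hence of split type
  and so its Weil classes are algebraic. It follows that the Weil classes of `(A₁,η₁,h₁)` are
  algebraic, by [schoen]. Hence, the Weil classes are algebraic on every abelian fourfold."; and
  **Corollary 1.3**: "The Hodge conjecture holds for abelian varieties of dimension `≤ 5`."
* E. Markman, *Cycles on abelian 2n-folds of Weil type from secant sheaves on abelian n-folds*,
  arXiv:2502.03415 (2025) [`Markman2025SecantWeil`], Theorem 1.5.1 (sixfolds, discriminant `-1`) and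
  Corollary 1.6.1 with its proof (chunk 7): "the Hodge-Weil classes are algebraic for every abelian
  fourfold of Weil-type, for all imaginary quadratic number fields, and for all discriminants".
* B. van Geemen, LNM 1594 (1994) [`vanGeemen1994HodgeAV`], Def. 4.9 (Weil type), Thm. 4.11, proof of
  Thm. 6.12 (the Weil plane is spanned by `⋀^{2n} W` and `⋀^{2n} W^*`), held book PDF pp. 218–232.

## What is vendored, and faithfulness

`Markman2025_weilClasses_algebraic_abelianFourfold` (named fact, D-0014): for `d ≥ 1`, a complex
abelian variety `A` of dimension `4` (`A.dim = 2 * 2`, `Motives.IsSmoothProjective (2 * 2) A.X`) with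
an endomorphism `φ : A ⟶ A`, `φ ≫ φ = -(d • 𝟙 A)` (so `K = ℚ(√-d) ↪ End⁰(A)`), every RATIONAL class
`c ∈ H⁴(A(ℂ); ℂ)` of Hodge type `(2,2)` lying in the Weil plane `weilClassesOf A φ 2 d` is algebraic
(`c ∈ algebraicClasses A.X 2 = N² H⁴`).

* "Weil classes" = rational classes in `⋀⁴_K H¹(A, ℚ)`; their `ℂ`-span is `E₊ ⊔ E₋ = weilClassesOf`
  (van Geemen, proof of Thm. 6.12; module docstring of `WeilClasses`). The fact asks for a rational
  class of the complexified plane: exactly a Weil class (`(W ⊗ ℂ) ∩ H⁴(A, ℚ) = W`).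
* "of Weil type" (signature `(2,2)`) is not a separate hypothesis: if `(A, K)` is of Weil type the
  Weil classes ARE of type `(2,2)` and the print theorem applies; if not, `E₊ = ⋀⁴V₊` and `E₋ = ⋀⁴V₋`
  are of pure Hodge types `(a, 4-a) ≠ (2,2)` and `(4-a, a)`, so a class of type `(2,2)` in `E₊ ⊕ E₋`
  is `0` and the conclusion is trivial. Requiring `√-d ∈ End(A)` (not merely `End⁰`) and `ℕ`-test
  endomorphisms only restricts the family of `(A, φ)` — never more than print.
* As for every fact of this layer concluding algebraicity from `IsOfHodgeType` (`HodgeConjectureFor`,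
  `lefschetzOneOne_rational`, `hodgeTwoTwo_algebraic_cubicFourfold`, …), the `∃`-over-Hodge-models
  convention of `IsOfHodgeType` is the standing one of the summit statement.
* NOT vendored: the sixfold half of Thm. 1.2 / Thm. 1.5.1 ("split Weil type" = discriminant `-1`
  needs a Riemann form on `H₁(A(ℂ), ℚ)` to instantiate `Motives.weilDiscriminant`; see the module
  docstring of `WeilClasses`), Cor. 1.3 (needs Moonen–Zarhin's classification, not in tree).

Consumer: support item `WeilFourfoldsBase` (stmt-HodgeConjecture-2525) of route
`HodgeConjecture/TropicalCuspLift` — literally this fact after `mem_weilClassesOf_iff`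
(`weilFourfoldsBase_shape_of` below states it in the route's inlined shape); calibration for
`NodalThetaWeil.FourfoldSupportedClassesAlgebraic` and the `n = 2` case of `WeilClassesAlgebraic`.

## References

* [Markman2025SurveySecant] E. Markman, Secant sheaves and Weil classes on abelian varieties,
  arXiv:2509.23403, Thm. 1.2, Cor. 1.3, §11.5 Step 2.
* [Markman2025SecantWeil] E. Markman, Cycles on abelian 2n-folds of Weil type from secant sheaves on
  abelian n-folds, arXiv:2502.03415, Thm. 1.5.1, Cor. 1.6.1.
* [Schoen1988HodgeWeil] C. Schoen, Hodge classes on self-products of a variety with an automorphism,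
  Compositio Math. 65 (1988) 3–32 (Markman's "[schoen1]").
* [Schoen1998HodgeWeilAddendum] C. Schoen, Addendum to: Hodge classes on self-products of a variety
  with an automorphism, Compositio Math. 114 (1998), no. 3 (Markman's "[schoen]": the
  degeneration/product argument of §11.5 Step 2 and of the proof of arXiv:2502.03415 Cor. 1.6.1).
* [vanGeemen1994HodgeAV] B. van Geemen, LNM 1594 (1994), 4.9, 4.11, Lemma 5.2, Thm. 6.12.
* [MoonenZarhin1999] B. Moonen, Yu. Zarhin, Hodge classes on abelian varieties of low dimension.
-/

noncomputable section

open CategoryTheory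

namespace Literature.AlgebraicGeometry.HodgeTheory

open Literature.AlgebraicTopology.SingularHomology

section HodgeTheory

/-- **Markman 2025 (arXiv:2509.23403 Thm. 1.2, fourfold half; arXiv:2502.03415 Cor. 1.6.1 proof):
Weil classes on abelian fourfolds of Weil type are algebraic, for every imaginary quadratic `K` and
every discriminant** — "Hence, the Weil classes are algebraic on every abelian fourfold" (§11.5
Step 2). Rendering: for `d ≥ 1`, `A` a complex abelian variety of dimension `4` with `φ : A ⟶ A`,
`φ ≫ φ = -(d • 𝟙 A)`, every rational class of Hodge type `(2,2)` in `H⁴(A(ℂ); ℂ)` lying in the Weil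
plane `weilClassesOf A φ 2 d = E₊ ⊔ E₋` lies in `algebraicClasses A.X 2`.
[cite: Markman2025SurveySecant, Thm. 1.2 and §11.5 Step 2] [cite: Markman2025SecantWeil, Cor. 1.6.1 (proof)]
[cite: vanGeemen1994HodgeAV, 4.9 and proof of Thm. 6.12] -/
def Markman2025_weilClasses_algebraic_abelianFourfold : Prop :=
  ∀ (d : ℕ), 0 < d → ∀ (A : Motives.AbelianVariety ℂ) (φ : A ⟶ A), A.dim = 2 * 2 →
    Motives.IsSmoothProjective (2 * 2) A.X → φ ≫ φ = -(d • 𝟙 A) →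
      ∀ c : singularCohomology ℂ ℂ (Motives.ComplexPoints A.X) (2 * 2), IsRationalClass c →
        IsOfHodgeType (2 * 2) A.X (2 * 2) 2 2 c → c ∈ weilClassesOf A φ 2 d →
          c ∈ algebraicClasses A.X 2

/-! ### Upper bound: the fact is an instance of the Hodge conjecture -/

/-- The Hodge conjecture for all smooth projective varieties (spelled with `HodgeConjectureFor`)
implies the fact: it is its instance over abelian fourfolds restricted to the Weil plane (nothing
stronger than the summit statement is claimed). [cite: Deligne2000, §1] -/
theorem Markman2025_weilClasses_algebraic_abelianFourfold_of_hodgeConjectureFor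
    (h : ∀ ⦃n : ℕ⦄ ⦃X : Motives.SchemeOver ℂ⦄, Motives.IsSmoothProjective n X → HodgeConjectureFor n X) :
    Markman2025_weilClasses_algebraic_abelianFourfold :=
  fun _ _ _ _ _ hX _ c hc h22 _ ↦ (h hX).2 2 c hc h22

/-! ### The consumer's literal shape -/

/-- **The fact in the inlined shape of route `TropicalCuspLift`** (`WeilFourfoldsBase`,
stmt-HodgeConjecture-2525: the Weil-plane membership spelled as `c = c₁ + c₂` with the two
eigen-conditions), by `mem_weilClassesOf_iff`. [cite: Markman2025SurveySecant, Thm. 1.2 and §11.5 Step 2] -/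
theorem Markman2025_weilClasses_algebraic_abelianFourfold.shape
    (h : Markman2025_weilClasses_algebraic_abelianFourfold) :
    ∀ (d : ℕ), 0 < d → ∀ (A : Motives.AbelianVariety ℂ) (φ : A ⟶ A), A.dim = 2 * 2 →
      Motives.IsSmoothProjective (2 * 2) A.X → φ ≫ φ = -(d • 𝟙 A) →
        ∀ c : singularCohomology ℂ ℂ (Motives.ComplexPoints A.X) (2 * 2), IsRationalClass c →
          IsOfHodgeType (2 * 2) A.X (2 * 2) 2 2 c →
            (∃ c₁ c₂ : singularCohomology ℂ ℂ (Motives.ComplexPoints A.X) (2 * 2), c = c₁ + c₂ ∧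
              (∀ x y : ℕ, singularCohomology.map ℂ ℂ
                  (Motives.AlgPoints.mapContinuous (L := ℂ) (x • 𝟙 A + y • φ).hom.hom.hom) (2 * 2) c₁ =
                ((x : ℂ) + (y : ℂ) * Complex.I * (Real.sqrt d : ℂ)) ^ (2 * 2) • c₁) ∧
              (∀ x y : ℕ, singularCohomology.map ℂ ℂ
                  (Motives.AlgPoints.mapContinuous (L := ℂ) (x • 𝟙 A + y • φ).hom.hom.hom) (2 * 2) c₂ =
                ((x : ℂ) - (y : ℂ) * Complex.I * (Real.sqrt d : ℂ)) ^ (2 * 2) • c₂)) →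
              c ∈ algebraicClasses A.X 2 :=
  fun d hd A φ hA hX hφ c hc h22 hW ↦ h d hd A φ hA hX hφ c hc h22 (mem_weilClassesOf_iff.2 hW)

/-- Sanity on the hypotheses: the zero class is a Weil class of every `(A, φ, n, d)` and is
algebraic, so the fact is consistent on its trivially inhabited instance. [folklore] -/
theorem zero_mem_weilClassesOf_and_algebraicClasses (A : Motives.AbelianVariety ℂ) (φ : A ⟶ A)
    (n d : ℕ) : (0 : complexBetti A.X (2 * n)) ∈ weilClassesOf A φ n d ∧
      (0 : complexBetti A.X (2 * n)) ∈ algebraicClasses A.X n :=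
  ⟨Submodule.zero_mem _, Submodule.zero_mem _⟩

/-! ### The action of `φ^*` on the Weil plane

`HW(A, η) = ⋀^{2n}_K H¹(A, ℚ)` is a `1`-dimensional `K`-vector space (Markman, arXiv:2509.23403 §1.1;
van Geemen 4.9), so `t ∈ K` acts on it by `t^{2n}` and `√-d` by `(-d)ⁿ`. On the real carriers this
is visible directly: both Weil characters take the value `(± i√d)^{2n} = (-d)ⁿ` at
`(x, y) = (0, 1)`, and `0·𝟙 + 1·φ = φ`. -/

/-- Pure arithmetic: `(i·√d)^{2n} = (-d)ⁿ` in `ℂ`, for `d : ℕ`. [folklore] -/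
theorem I_mul_sqrt_pow_two_mul (d n : ℕ) :
    (Complex.I * (Real.sqrt d : ℂ)) ^ (2 * n) = (-(d : ℂ)) ^ n := by
  have hsq : ((Real.sqrt d : ℝ) : ℂ) ^ 2 = (d : ℂ) := by
    rw [← Complex.ofReal_pow, Real.sq_sqrt (Nat.cast_nonneg _), Complex.ofReal_natCast]
  rw [pow_mul, mul_pow, Complex.I_sq, hsq, neg_one_mul]

/-- Pure arithmetic: `(-i·√d)^{2n} = (-d)ⁿ` in `ℂ`, for `d : ℕ`. [folklore] -/
theorem neg_I_mul_sqrt_pow_two_mul (d n : ℕ) :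
    (-(Complex.I * (Real.sqrt d : ℂ))) ^ (2 * n) = (-(d : ℂ)) ^ n := by
  rw [pow_mul, neg_sq, ← pow_mul, I_mul_sqrt_pow_two_mul]

/-- **`φ^*` acts on the Weil plane `E₊ ⊔ E₋ ⊆ H²ⁿ(A(ℂ); ℂ)` as the scalar `(-d)ⁿ`**: for
`c ∈ weilClassesOf A φ n d`, `φ^* c = (-d)ⁿ · c` — instantiate both eigen-conditions at
`(x, y) = (0, 1)`, where `0·𝟙_A + 1·φ = φ` and `(± i√d)^{2n} = (-d)ⁿ`. This is the real-carrier
shadow of "`HW(A, η) := ⋀^d_K H¹(A, ℚ)` … is a `1`-dimensional `K`-vector space" (Markman §1.1,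
`d = dim_K H¹ = 2n`), on which `√-d ∈ K` acts through `⋀^{2n}_K` by `(√-d)^{2n} = (-d)ⁿ`; for the
fourfolds of `Markman2025_weilClasses_algebraic_abelianFourfold` (`n = 2`), `φ^* c = d² · c`.
[cite: Markman2025SurveySecant, §1.1] [cite: vanGeemen1994HodgeAV, 4.9] -/
theorem map_eq_smul_of_mem_weilClassesOf {A : Motives.AbelianVariety ℂ} {φ : A ⟶ A} {n d : ℕ}
    {c : complexBetti A.X (2 * n)} (hc : c ∈ weilClassesOf A φ n d) :
    singularCohomology.map ℂ ℂ (Motives.AlgPoints.mapContinuous (L := ℂ) φ.hom.hom.hom) (2 * n) c =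
      ((-(d : ℂ)) ^ n) • c := by
  rw [weilClassesOf, Submodule.mem_sup] at hc
  obtain ⟨c₁, h₁, c₂, h₂, rfl⟩ := hc
  have hφ : ((0 : ℕ) • 𝟙 A + (1 : ℕ) • φ : A ⟶ A) = φ := by simp
  have e₁ := (mem_weilClassesPlus_iff.mp h₁) 0 1
  have e₂ := (mem_weilClassesMinus_iff.mp h₂) 0 1
  rw [hφ] at e₁ e₂
  simp only [Nat.cast_zero, Nat.cast_one, zero_add, zero_sub, one_mul] at e₁ e₂
  rw [I_mul_sqrt_pow_two_mul] at e₁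
  rw [neg_I_mul_sqrt_pow_two_mul] at e₂
  rw [map_add, e₁, e₂, smul_add]

/-- In the setting of the fact (`n = 2`): `φ^*` fixes the Weil plane of an abelian fourfold up to
the factor `d² = Nm_{K/ℚ}(√-d)²`, i.e. `φ^* c = d² · c` for every `c ∈ weilClassesOf A φ 2 d`.
[cite: Markman2025SurveySecant, §1.1] -/
theorem map_eq_smul_of_mem_weilClassesOf_two {A : Motives.AbelianVariety ℂ} {φ : A ⟶ A} {d : ℕ}
    {c : complexBetti A.X (2 * 2)} (hc : c ∈ weilClassesOf A φ 2 d) :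
    singularCohomology.map ℂ ℂ (Motives.AlgPoints.mapContinuous (L := ℂ) φ.hom.hom.hom) (2 * 2) c =
      ((d : ℂ) ^ 2) • c := by
  rw [map_eq_smul_of_mem_weilClassesOf hc, neg_sq]

end HodgeTheory

end Literature.AlgebraicGeometry.HodgeTheory

end
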